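import Literature.Geometry.GeometricMeasureTheory.RectifiableNormalize
import Literature.Geometry.GeometricMeasureTheory.MassFormula

/-!
# `𝐌`-completeness of the rectifiable currents `𝓡_{m,K}(V)`

For the concrete rectifiable currents of `Literature.Geometry.GeometricMeasureTheory.Currents`
(currents of integration `[W, θ, ξ]` with admissible data and compact support) on a
finite-dimensional inner product space `V`:

* `mass_vectorCurrent_le`, `mass_vectorCurrent_eq_lintegral` — **`𝐌(μ ∧ F) = ∫ ‖F‖ dμ`** on the
  whole space for locally integrable `F` ("‖μ ∧ η‖ = μ ⌞ ‖η‖", Federer 4.1.5, 4.1.7);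
* `exists_ae_tendsto_of_tsum_lintegral_ne_top` — a sequence of vector fields with
  `Σ ∫ ‖G_{i+1} − G_i‖ < ∞` converges a.e. and in `L¹`;
* `Current.IsRectifiable.exists_data_subset` — rectifiable currents supported in a compact `K`
  have normalised data carried by `K` (`𝓗^m(W) < ∞`, `θ ≠ 0` a.e.);
* `Current.IsRectifiable.exists_limit_of_tsum_mass_ne_top`,
  `Current.IsRectifiable.complete_mass` — **"`𝓡_{m,K}(U)` … are `𝐌` complete"** (Federer
  4.1.24): an `𝐌`-Cauchy sequence in `𝓡_m(V)` with supports in the compact `K` converges in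
  mass to some `T ∈ 𝓡_m(V)` with `spt T ⊆ K`. On the common carrier `W = ⋃ Wᵢ ⊆ K`
  (`𝓗^m(W) < ∞` because `𝓗^m(W_{i+1} ∖ Wᵢ) ≤ 𝐌(T_{i+1} − Tᵢ)`), `Tᵢ = (𝓗^m ⌞ W) ∧ Gᵢ` and
  `𝐌(Tᵢ − Tⱼ) = ∫ ‖Gᵢ − Gⱼ‖`; the `Gᵢ(x)` are integer multiples of the unit simple `m`-vector of
  the common tangent plane `Tan^m(𝓗^m ⌞ W, x)` (3.2.19 via `RectifiableNormalize.lean`, frame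
  alignment), so the a.e. limit is such a multiple as well (`exists_int_smul_of_tendsto`) and
  defines admissible data for the limit current.

Source: H. Federer, *Geometric Measure Theory*, Springer 1969 (`Federer1969`), 4.1.5, 4.1.7,
4.1.24, 4.1.28 (held copy `lit book:federernd-geometric-measure-theory`, PDF pp. 296–301,
321–326).
-/

noncomputable section

open MeasureTheory MeasureTheory.Measure Set Function Filter Metric TopologicalSpace
open scoped ENNReal NNReal Topology

namespace Literature.Geometry.GeometricMeasureTheory

-- Depth 3: `Integrable`-algebra on `Multivector`-valued maps (see `RectifiableAdd.lean`).
set_option maxSynthPendingDepth 3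

/-! ### The mass of `μ ∧ F` on the whole space -/

section MassVectorCurrent

variable {E : Type*} [NormedAddCommGroup E] [NormedSpace ℝ E] [MeasurableSpace E]
  [OpensMeasurableSpace E] {Ω : Opens E} {m : ℕ}

/-- **`𝐌(μ ∧ F) ≤ ∫ ‖F‖ dμ`** (`|⟨φ, F⟩| ≤ ‖φ‖ ‖F‖ ≤ ‖F‖` for test forms of comass `≤ 1`).
[cite: Federer1969, 4.1.5, 4.1.7] -/
theorem mass_vectorCurrent_le (μ : Measure E) (F : E → Multivector E m) :
    (vectorCurrent μ F : Current Ω m).mass ≤ ∫⁻ x, ‖F x‖ₑ ∂μ := by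
  by_cases hF : LocallyIntegrableOn F (Ω : Set E) μ
  · refine iSup₂_le fun φ hφ => ?_
    rw [vectorCurrent_apply hF]
    refine (ENNReal.ofReal_le_ofReal (le_abs_self _)).trans ?_
    rw [← Real.norm_eq_abs, ofReal_norm]
    refine (enorm_integral_le_lintegral_enorm _).trans (lintegral_mono fun x => ?_)
    rw [← ofReal_norm, ← ofReal_norm]
    apply ENNReal.ofReal_le_ofReal
    calc ‖F x (φ x)‖ ≤ ‖F x‖ * ‖φ x‖ := (F x).le_opNorm _
      _ ≤ ‖F x‖ * 1 := by gcongr; exact hφ x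
      _ = ‖F x‖ := mul_one _
  · rw [vectorCurrent_of_not_locallyIntegrableOn hF, Current.mass_zero]
    exact bot_le

end MassVectorCurrent

section MassVectorCurrentTop

variable {V : Type*} [NormedAddCommGroup V] [InnerProductSpace ℝ V] [FiniteDimensional ℝ V]
  [MeasurableSpace V] [BorelSpace V] {m : ℕ}

/-- **`𝐌(μ ∧ F) = ∫ ‖F‖ dμ` on the whole space** for locally integrable `F`
("‖μ ∧ η‖ = μ ⌞ ‖η‖"). [cite: Federer1969, 4.1.5, 4.1.7] -/
theorem mass_vectorCurrent_eq_lintegral {μ : Measure V} {F : V → Multivector V m}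
    (hF : LocallyIntegrableOn F (((⊤ : Opens V)) : Set V) μ) :
    (vectorCurrent μ F : Current (⊤ : Opens V) m).mass = ∫⁻ x, ‖F x‖ₑ ∂μ := by
  refine le_antisymm (mass_vectorCurrent_le μ F) ?_
  have hmono : Monotone fun n : ℕ => closedBall (0 : V) n := fun a b hab =>
    closedBall_subset_closedBall (by exact_mod_cast hab)
  have hcov : (⋃ n : ℕ, closedBall (0 : V) n) = univ :=
    eq_univ_of_forall fun x => by
      obtain ⟨n, hn⟩ := exists_nat_ge ‖x‖
      exact mem_iUnion.2 ⟨n, by simpa using hn⟩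
  calc ∫⁻ x, ‖F x‖ₑ ∂μ = ∫⁻ x in ⋃ n : ℕ, closedBall (0 : V) n, ‖F x‖ₑ ∂μ := by
        rw [hcov, Measure.restrict_univ]
    _ = ⨆ n : ℕ, ∫⁻ x in closedBall (0 : V) n, ‖F x‖ₑ ∂μ :=
        setLIntegral_iUnion_of_directed _ hmono.directed_le
    _ ≤ (vectorCurrent μ F : Current (⊤ : Opens V) m).mass := iSup_le fun n =>
        setLIntegral_enorm_le_mass_vectorCurrent hF (isCompact_closedBall 0 n) (by simp)

end MassVectorCurrentTop

/-! ### Countable unions of countably rectifiable sets -/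

section RectUnion

variable {V : Type*} [NormedAddCommGroup V] [MeasurableSpace V] [BorelSpace V] {m : ℕ}

/-- A countable union of countably `m`-rectifiable sets is countably `m`-rectifiable.
[cite: Federer1969, 3.2.14] -/
theorem IsCountablyRectifiable.iUnion {W : ℕ → Set V} (h : ∀ i, IsCountablyRectifiable m (W i)) :
    IsCountablyRectifiable m (⋃ i, W i) := by
  choose f hf h0 using h
  refine ⟨fun n => f (Nat.unpair n).1 (Nat.unpair n).2, fun n => hf _ _, ?_⟩
  refine measure_mono_null ?_ (measure_iUnion_null h0)
  rintro x ⟨hx, hxU⟩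
  obtain ⟨i, hi⟩ := mem_iUnion.1 hx
  refine mem_iUnion.2 ⟨i, hi, fun h => hxU ?_⟩
  obtain ⟨j, hj⟩ := mem_iUnion.1 h
  refine mem_iUnion.2 ⟨Nat.pair i j, ?_⟩
  simpa [Nat.unpair_pair] using hj

end RectUnion

/-! ### Almost everywhere limits from summable `L¹` increments -/

section L1Limit

variable {X : Type*} [MeasurableSpace X] {E : Type*} [NormedAddCommGroup E] [CompleteSpace E]

/-- **A sequence with summable `L¹` increments converges a.e. and in `L¹`.** If
`Σᵢ ∫ ‖G (i+1) − G i‖ dμ < ∞` then `G i → G∞` a.e. for an a.e.-strongly measurable `G∞` with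
`∫ ‖G i − G∞‖ dμ ≤ Σ_{k} ∫ ‖G (i+k+1) − G (i+k)‖ dμ → 0` (the step "we can choose Rᵢ, Sᵢ … so that
Σ [𝐌(Rᵢ) + 𝐌(Sᵢ)] < ∞, hence conclude …" of the completeness proofs). [folklore] -/
theorem exists_ae_tendsto_of_tsum_lintegral_ne_top (μ : Measure X) (G : ℕ → X → E)
    (hG : ∀ i, AEStronglyMeasurable (G i) μ)
    (hsum : ∑' i, ∫⁻ x, ‖G (i + 1) x - G i x‖ₑ ∂μ ≠ ⊤) :
    ∃ Glim : X → E, AEStronglyMeasurable Glim μ ∧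
      (∀ᵐ x ∂μ, Tendsto (fun i => G i x) atTop (𝓝 (Glim x))) ∧
      (∀ i, ∫⁻ x, ‖G i x - Glim x‖ₑ ∂μ ≤ ∑' k, ∫⁻ x, ‖G (k + i + 1) x - G (k + i) x‖ₑ ∂μ) ∧
      Tendsto (fun i => ∫⁻ x, ‖G i x - Glim x‖ₑ ∂μ) atTop (𝓝 0) := by
  -- the increments
  set d : ℕ → X → ℝ≥0∞ := fun k x => ‖G (k + 1) x - G k x‖ₑ with hd
  have hdm : ∀ k, AEMeasurable (d k) μ := fun k => ((hG (k + 1)).sub (hG k)).enorm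
  have htsum : ∫⁻ x, ∑' k, d k x ∂μ = ∑' k, ∫⁻ x, d k x ∂μ := lintegral_tsum hdm
  have hmeas : AEMeasurable (fun x => ∑' k, d k x) μ := by
    simp_rw [ENNReal.tsum_eq_iSup_sum]
    exact .iSup fun s => Finset.aemeasurable_fun_sum s fun i _ => hdm i
  have hfin : ∀ᵐ x ∂μ, ∑' k, d k x < ⊤ := by
    refine ae_lt_top' hmeas ?_
    rw [htsum]
    exact hsum
  -- pointwise Cauchy, hence convergent
  have hconv : ∀ᵐ x ∂μ, ∃ a, Tendsto (fun i => G i x) atTop (𝓝 a) := by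
    filter_upwards [hfin] with x hx
    refine cauchySeq_tendsto_of_complete (cauchySeq_of_edist_le_of_tsum_ne_top (fun k => d k x)
      (fun k => ?_) hx.ne)
    rw [edist_comm, edist_eq_enorm_sub]
  let Glim : X → E := fun x => limUnder atTop fun i => G i x
  have hlim : ∀ᵐ x ∂μ, Tendsto (fun i => G i x) atTop (𝓝 (Glim x)) := by
    filter_upwards [hconv] with x hx
    exact tendsto_nhds_limUnder hx
  have hGlim : AEStronglyMeasurable Glim μ := aestronglyMeasurable_of_tendsto_ae atTop hG hlim
  -- the `L¹` bound by the tail sums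
  have hbound : ∀ i, ∫⁻ x, ‖G i x - Glim x‖ₑ ∂μ ≤ ∑' k, ∫⁻ x, ‖G (k + i + 1) x - G (k + i) x‖ₑ ∂μ := by
    intro i
    have h1 : ∀ᵐ x ∂μ, ‖G i x - Glim x‖ₑ ≤ ∑' k, d (i + k) x := by
      filter_upwards [hlim] with x hx
      rw [← edist_eq_enorm_sub]
      exact edist_le_tsum_of_edist_le_of_tendsto (fun k => d k x)
        (fun k => by rw [edist_comm, edist_eq_enorm_sub]) hx i
    calc ∫⁻ x, ‖G i x - Glim x‖ₑ ∂μ ≤ ∫⁻ x, ∑' k, d (i + k) x ∂μ := lintegral_mono_ae h1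
      _ = ∑' k, ∫⁻ x, d (i + k) x ∂μ := lintegral_tsum fun k => hdm (i + k)
      _ = ∑' k, ∫⁻ x, ‖G (k + i + 1) x - G (k + i) x‖ₑ ∂μ := by
          congr 1
          funext k
          simp only [hd, add_comm i k]
  refine ⟨Glim, hGlim, hlim, hbound, ?_⟩
  have htail : Tendsto (fun i => ∑' k, ∫⁻ x, ‖G (k + i + 1) x - G (k + i) x‖ₑ ∂μ) atTop (𝓝 0) := by
    have := ENNReal.tendsto_sum_nat_add (fun k => ∫⁻ x, ‖G (k + 1) x - G k x‖ₑ ∂μ) hsum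
    simpa [add_assoc] using this
  exact tendsto_of_tendsto_of_tendsto_of_le_of_le tendsto_const_nhds htail (fun _ => bot_le) hbound

end L1Limit


/-! ### Lattice limits and frame alignment -/

section Lattice

variable {E : Type*} [NormedAddCommGroup E] [NormedSpace ℝ E]

/-- **Limits of integer multiples of a unit vector are integer multiples**: if `‖u‖ = 1`,
`g i ∈ ℤ u` and `g i → L`, then `L = n u` for some `n ∈ ℤ` (the sequence is eventually constant,
consecutive lattice points being at distance `≥ 1`). [folklore] -/
theorem exists_int_smul_of_tendsto {u : E} (hu : ‖u‖ = 1) {g : ℕ → E}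
    (hg : ∀ i, ∃ n : ℤ, g i = (n : ℝ) • u) {L : E} (hL : Tendsto g atTop (𝓝 L)) :
    ∃ n : ℤ, L = (n : ℝ) • u := by
  choose n hn using hg
  obtain ⟨N, hN⟩ := Metric.cauchySeq_iff'.1 hL.cauchySeq 1 one_pos
  have hconst : ∀ i ≥ N, g i = g N := by
    intro i hi
    have h1 := hN i hi
    rw [hn i, hn N, dist_eq_norm, ← sub_smul, norm_smul, hu, mul_one, ← Int.cast_sub,
      Real.norm_eq_abs, ← Int.cast_abs, ← Int.cast_one, Int.cast_lt, Int.abs_lt_one_iff,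
      sub_eq_zero] at h1
    rw [hn i, hn N, h1]
  refine ⟨n N, ?_⟩
  have h3 : Tendsto g atTop (𝓝 (g N)) :=
    tendsto_const_nhds.congr' (eventually_atTop.2 ⟨N, fun i hi => (hconst i hi).symm⟩)
  rw [tendsto_nhds_unique hL h3, hn N]

end Lattice

section AlignFrame

variable {V : Type*} [NormedAddCommGroup V] [InnerProductSpace ℝ V] {m : ℕ}

/-- An integer multiple of the simple `m`-vector of an orthonormal frame is an integer multiple of
the simple `m`-vector of any other orthonormal frame with the same span.
[cite: Federer1969, 1.6.1 with 4.1.28 (4)] -/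
theorem exists_int_smul_frameVector_of_span_eq {v w : Fin m → V} (hv : Orthonormal ℝ v)
    (hw : Orthonormal ℝ w)
    (h : Submodule.span ℝ (Set.range w) = Submodule.span ℝ (Set.range v)) (θ : ℤ) :
    ∃ n : ℤ, (θ : ℝ) • frameVector w = (n : ℝ) • frameVector v := by
  rcases frameVector_eq_or_eq_neg_of_span_eq hv hw h with h1 | h1
  · exact ⟨θ, by rw [h1]⟩
  · exact ⟨-θ, by rw [h1, smul_neg, Int.cast_neg, neg_smul]⟩

end AlignFrame

/-! ### `𝐌`-completeness of `𝓡_{m,K}(V)` -/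

section MassComplete

variable {V : Type*} [NormedAddCommGroup V] [InnerProductSpace ℝ V] [FiniteDimensional ℝ V]
  [MeasurableSpace V] [BorelSpace V] {m : ℕ}

/-- `μ ∧ η₁ - μ ∧ η₂ = μ ∧ (η₁ - η₂)` for locally integrable densities. [cite: Federer1969, 4.1.7] -/
theorem vectorCurrent_sub {E : Type*} [NormedAddCommGroup E] [NormedSpace ℝ E] [MeasurableSpace E]
    [OpensMeasurableSpace E] {Ω : Opens E} {μ : Measure E} {η₁ η₂ : E → Multivector E m}
    (h₁ : LocallyIntegrableOn η₁ (Ω : Set E) μ) (h₂ : LocallyIntegrableOn η₂ (Ω : Set E) μ) :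
    (vectorCurrent μ (η₁ - η₂) : Current Ω m) = vectorCurrent μ η₁ - vectorCurrent μ η₂ := by
  have h₂' : LocallyIntegrableOn (fun x => -η₂ x) (Ω : Set E) μ := h₂.neg
  have e : η₁ - η₂ = η₁ + fun x => -η₂ x := by
    funext x
    simp [sub_eq_add_neg]
  rw [e, vectorCurrent_add h₁ h₂', vectorCurrent_neg, ← sub_eq_add_neg]

/-- **Rectifiable currents with support in a compact `K` have normalised data carried by `K`**:
`T = [W, θ, ξ]` with `W ⊆ K`, `𝓗^m(W) < ∞` and `θ ≠ 0` a.e. on `W` (normal form, and the density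
vanishes a.e. off `spt T`). [cite: Federer1969, 4.1.28 (4)] -/
theorem Current.IsRectifiable.exists_data_subset {T : Current (⊤ : Opens V) m}
    (hT : T.IsRectifiable) {K : Set V} (hK : IsCompact K) (hTK : T.support ⊆ K) :
    ∃ (W : Set V) (θ : V → ℤ) (ξ : V → Fin m → V), IsRectifiableData (⊤ : Opens V) m W θ ξ ∧
      T = currentOfIntegration W θ ξ ∧ W ⊆ K ∧ (μHE[m] : Measure V) W < ⊤ ∧
      ∀ᵐ x ∂((μHE[m] : Measure V).restrict W), θ x ≠ 0 := by
  obtain ⟨W₀, θ, ξ, hd₀, rfl⟩ := hT.1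
  obtain ⟨W₁, -, hd₁, heq₁, hθ₁, hfin₁⟩ := hd₀.exists_subset_normalized
  have hW₁m : MeasurableSet W₁ := hd₁.1
  have hKm : MeasurableSet K := hK.isClosed.measurableSet
  refine ⟨W₁ ∩ K, θ, ξ, hd₁.subset (hW₁m.inter hKm) inter_subset_left, ?_, inter_subset_right,
    hfin₁ K hK (by simp), ae_mono (Measure.restrict_mono inter_subset_left le_rfl) hθ₁⟩
  -- `[W₁ ∩ K, θ, ξ] = [W₁, θ, ξ]`: the density vanishes a.e. on `W₁ ∖ K ⊆ V ∖ spt T`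
  rw [← heq₁] at hTK ⊢
  have hz := ae_eq_zero_of_mem_sdiff_support_vectorCurrent (m := m) (Ω := (⊤ : Opens V))
    hd₁.2.2.2.1
  rw [currentOfIntegration_eq_vectorCurrent_indicator hW₁m,
    currentOfIntegration_eq_vectorCurrent_indicator (hW₁m.inter hKm)]
  refine vectorCurrent_congr_ae ?_
  filter_upwards [(ae_restrict_iff' hW₁m).1 hz] with x hx
  by_cases hxW : x ∈ W₁
  · by_cases hxK : x ∈ K
    · rw [indicator_of_mem hxW, indicator_of_mem (show x ∈ W₁ ∩ K from ⟨hxW, hxK⟩)]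
    · rw [indicator_of_mem hxW, indicator_of_notMem (show x ∉ W₁ ∩ K from fun h => hxK h.2)]
      exact hx hxW ⟨by simp, fun h => hxK (hTK h)⟩
  · rw [indicator_of_notMem hxW, indicator_of_notMem (show x ∉ W₁ ∩ K from fun h => hxW h.1)]

/-- **`𝐌`-completeness of `𝓡_{m,K}(V)`, summable form** ("𝓡_{m,K}(U) … are 𝐌 complete"): if
`Tᵢ ∈ 𝓡_m(V)` have supports in the compact `K` and `Σᵢ 𝐌(Tᵢ₊₁ − Tᵢ) < ∞`, then `𝐌(Tᵢ − T) → 0`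
for some `T ∈ 𝓡_m(V)` with `spt T ⊆ K`. Proof: on the common carrier `W = ⋃ Wᵢ ⊆ K`
(`𝓗^m(W) < ∞` since `𝓗^m(Wᵢ₊₁ ∖ Wᵢ) ≤ 𝐌(Tᵢ₊₁ − Tᵢ)`), `Tᵢ = (𝓗^m ⌞ W) ∧ Gᵢ` with
`𝐌(Tᵢ₊₁ − Tᵢ) = ∫_W ‖Gᵢ₊₁ − Gᵢ‖ d𝓗^m`; so `Gᵢ → G` a.e. and in `L¹`; a.e. the `Gᵢ(x)` are integer
multiples of the unit simple `m`-vector of the common tangent plane `Tan^m(𝓗^m ⌞ W, x)` (frame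
alignment, 3.2.19), hence so is `G(x)`, and `T = (𝓗^m ⌞ W) ∧ G` is rectifiable.
[cite: Federer1969, 4.1.24 (with 4.1.28)] -/
theorem Current.IsRectifiable.exists_limit_of_tsum_mass_ne_top {K : Set V} (hK : IsCompact K)
    (T : ℕ → Current (⊤ : Opens V) m) (hT : ∀ i, (T i).IsRectifiable)
    (hTK : ∀ i, (T i).support ⊆ K) (hsum : ∑' i, (T (i + 1) - T i).mass ≠ ⊤) :
    ∃ T' : Current (⊤ : Opens V) m, T'.IsRectifiable ∧ T'.support ⊆ K ∧
      Tendsto (fun i => (T i - T').mass) atTop (𝓝 0) := by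
  classical
  have hKm : MeasurableSet K := hK.isClosed.measurableSet
  -- Step 1: normalised data carried by `K`
  choose W θ ξ hd hTeq hWK hWfin hθ using fun i => (hT i).exists_data_subset hK (hTK i)
  have hWm : ∀ i, MeasurableSet (W i) := fun i => (hd i).1
  -- Step 2: the common carrier
  set Wu : Set V := ⋃ i, W i with hWu
  have hWum : MeasurableSet Wu := MeasurableSet.iUnion hWm
  have hWuK : Wu ⊆ K := iUnion_subset hWK
  have hWur : IsCountablyRectifiable m Wu := IsCountablyRectifiable.iUnion fun i => (hd i).2.2.1
  set μ : Measure V := (μHE[m] : Measure V).restrict Wu with hμ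
  have hμle : μ ≤ (μHE[m] : Measure V) := Measure.restrict_le_self
  -- the extended densities `G i = 𝟙_{W i} θᵢ ξᵢ`
  set F : ℕ → V → Multivector V m := fun i x => (θ i x : ℝ) • frameVector (ξ i x) with hF
  set G : ℕ → V → Multivector V m := fun i => (W i).indicator (F i) with hG
  have hFint : ∀ i, Integrable (F i) ((μHE[m] : Measure V).restrict (W i)) := by
    intro i
    have h1 : IntegrableOn (F i) K ((μHE[m] : Measure V).restrict (W i)) :=
      (hd i).2.2.2.1.integrableOn_compact_subset (by simp) hK
    rwa [IntegrableOn, Measure.restrict_restrict hKm, inter_eq_right.2 (hWK i)] at h1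
  have hGint' : ∀ i, Integrable (G i) (μHE[m] : Measure V) := fun i =>
    (integrable_indicator_iff (hWm i)).2 (hFint i)
  have hGint : ∀ i, Integrable (G i) μ := fun i => (hGint' i).mono_measure hμle
  have hGli : ∀ i, LocallyIntegrableOn (G i) ((⊤ : Opens V) : Set V) μ := fun i =>
    (hGint i).locallyIntegrable.locallyIntegrableOn _
  -- `T i = μ ∧ G i`
  have hTG : ∀ i, T i = vectorCurrent μ (G i) := by
    intro i
    rw [hTeq i, currentOfIntegration_eq_vectorCurrent_indicator (hWm i), hμ,
      ← vectorCurrent_indicator _ hWum, Set.indicator_indicator,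
      inter_eq_right.2 (subset_iUnion W i)]
  -- Step 3: masses of differences are `L¹` distances
  have hmass : ∀ i j, (T i - T j).mass = ∫⁻ x, ‖G i x - G j x‖ₑ ∂μ := by
    intro i j
    rw [hTG, hTG, ← vectorCurrent_sub (hGli i) (hGli j),
      mass_vectorCurrent_eq_lintegral ((hGli i).sub (hGli j))]
    rfl
  have hsum' : ∑' i, ∫⁻ x, ‖G (i + 1) x - G i x‖ₑ ∂μ ≠ ⊤ := by
    have : (fun i => ∫⁻ x, ‖G (i + 1) x - G i x‖ₑ ∂μ) = fun i => (T (i + 1) - T i).mass :=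
      funext fun i => (hmass (i + 1) i).symm
    rwa [this]
  -- Step 4: the `L¹` and a.e. limit `Glim`
  obtain ⟨Glim, hGlim_m, hGlim_ae, hGlim_bd, hGlim_L1⟩ :=
    exists_ae_tendsto_of_tsum_lintegral_ne_top μ G (fun i => (hGint i).1) hsum'
  -- Step 5: `𝓗^m(Wu) < ∞`
  have hWufin : (μHE[m] : Measure V) Wu < ⊤ := by
    -- `𝓗^m(W (i+1) ∖ W i) ≤ ∫ ‖G (i+1) - G i‖ dμ`
    have hstep : ∀ i, (μHE[m] : Measure V) (W (i + 1) \ W i) ≤ ∫⁻ x, ‖G (i + 1) x - G i x‖ₑ ∂μ := by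
      intro i
      have hDm : MeasurableSet (W (i + 1) \ W i) := (hWm (i + 1)).diff (hWm i)
      have h1 : (μHE[m] : Measure V) (W (i + 1) \ W i) = μ (W (i + 1) \ W i) := by
        rw [hμ, Measure.restrict_apply hDm,
          inter_eq_left.2 (Set.sdiff_subset.trans (subset_iUnion W (i + 1)))]
      -- a.e. on `W (i+1)`: `‖G (i+1) - G i‖ ≥ 1` off `W i`
      have h2 : ∀ᵐ x ∂μ, x ∈ W (i + 1) \ W i → (1 : ℝ≥0∞) ≤ ‖G (i + 1) x - G i x‖ₑ := by
        have h3 : ∀ᵐ x ∂(μHE[m] : Measure V), x ∈ W (i + 1) →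
            (Orthonormal ℝ (ξ (i + 1) x) ∧ θ (i + 1) x ≠ 0) := by
          rw [← ae_restrict_iff' (hWm (i + 1))]
          filter_upwards [(hd (i + 1)).2.2.2.2, hθ (i + 1)] with x hx hθx
          exact ⟨hx.1, hθx⟩
        filter_upwards [ae_mono hμle h3] with x hx hxD
        obtain ⟨hon, hθx⟩ := hx hxD.1
        rw [hG]
        simp only [indicator_of_mem hxD.1, indicator_of_notMem hxD.2, sub_zero, hF]
        rw [enorm_smul, ← ofReal_norm (frameVector (ξ (i + 1) x)), norm_frameVector_eq_one hon,
          ENNReal.ofReal_one, mul_one, ← ofReal_norm, ← ENNReal.ofReal_one]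
        apply ENNReal.ofReal_le_ofReal
        rw [Real.norm_eq_abs, ← Int.cast_abs, ← Int.cast_one, Int.cast_le]
        exact Int.one_le_abs hθx
      rw [h1]
      calc μ (W (i + 1) \ W i) = ∫⁻ x in W (i + 1) \ W i, (1 : ℝ≥0∞) ∂μ := by
            rw [setLIntegral_one]
        _ ≤ ∫⁻ x in W (i + 1) \ W i, ‖G (i + 1) x - G i x‖ₑ ∂μ := by
            refine lintegral_mono_ae ?_
            filter_upwards [ae_restrict_mem hDm, ae_restrict_of_ae h2] with x hx hx'
            exact hx' hx
        _ ≤ ∫⁻ x, ‖G (i + 1) x - G i x‖ₑ ∂μ := lintegral_mono' Measure.restrict_le_self le_rfl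
    have hcov : Wu ⊆ W 0 ∪ ⋃ i, (W (i + 1) \ W i) := by
      intro x hx
      have hex : ∃ i, x ∈ W i := mem_iUnion.1 hx
      rcases Nat.eq_zero_or_pos (Nat.find hex) with h0 | hpos
      · exact Or.inl (h0 ▸ Nat.find_spec hex)
      · right
        obtain ⟨k, hk⟩ := Nat.exists_eq_add_of_lt hpos
        rw [zero_add] at hk
        refine mem_iUnion.2 ⟨k, ?_, fun h => ?_⟩
        · have := Nat.find_spec hex
          rwa [hk] at this
        · have := Nat.find_min hex (show k < Nat.find hex by omega)
          exact this h
    calc (μHE[m] : Measure V) Wu ≤ (μHE[m] : Measure V) (W 0 ∪ ⋃ i, (W (i + 1) \ W i)) :=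
          measure_mono hcov
      _ ≤ (μHE[m] : Measure V) (W 0) + ∑' i, (μHE[m] : Measure V) (W (i + 1) \ W i) :=
          (measure_union_le _ _).trans (add_le_add le_rfl (measure_iUnion_le _))
      _ ≤ (μHE[m] : Measure V) (W 0) + ∑' i, ∫⁻ x, ‖G (i + 1) x - G i x‖ₑ ∂μ := by
          gcongr with i
          exact hstep i
      _ < ⊤ := ENNReal.add_lt_top.2 ⟨hWfin 0, lt_top_iff_ne_top.2 hsum'⟩
  haveI hfinμ : IsFiniteMeasure μ := by
    refine ⟨?_⟩
    rw [hμ, Measure.restrict_apply MeasurableSet.univ, univ_inter]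
    exact hWufin
  -- Step 6: the common tangent planes
  have hplane : ∀ i, ∀ᵐ x ∂μ, x ∈ W i → (Orthonormal ℝ (ξ i x) ∧ θ i x ≠ 0 ∧
      ((Submodule.span ℝ (range (ξ i x)) : Set V) = approxTangentCone m μ x)) := by
    intro i
    haveI : IsLocallyFiniteMeasure ((μHE[m] : Measure V).restrict Wu) := by
      rw [← hμ]; infer_instance
    have h1 := ae_approxTangentCone_union_eq (m := m) (hWm i) hWum
    rw [union_eq_right.2 (subset_iUnion W i)] at h1
    have h2 : ∀ᵐ x ∂(μHE[m] : Measure V).restrict (W i), Orthonormal ℝ (ξ i x) ∧ θ i x ≠ 0 ∧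
        ((Submodule.span ℝ (range (ξ i x)) : Set V) = approxTangentCone m μ x) := by
      filter_upwards [(hd i).2.2.2.2, hθ i, h1] with x hx hθx hT
      exact ⟨hx.1, hθx, hx.2.trans hT.symm⟩
    exact ae_mono hμle ((ae_restrict_iff' (hWm i)).1 h2)
  have hWuμ : ∀ᵐ x ∂μ, x ∈ Wu := ae_restrict_mem hWum
  -- Step 7: pointwise structure of the limit
  have hstruct : ∀ᵐ x ∂μ, ∃ hx : ∃ i, x ∈ W i, Orthonormal ℝ (ξ (Nat.find hx) x) ∧
      ((Submodule.span ℝ (range (ξ (Nat.find hx) x)) : Set V) = approxTangentCone m μ x) ∧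
      ∃ n : ℤ, Glim x = (n : ℝ) • frameVector (ξ (Nat.find hx) x) := by
    filter_upwards [ae_all_iff.2 hplane, hWuμ, hGlim_ae] with x hP hxW hlim
    have hex : ∃ i, x ∈ W i := mem_iUnion.1 hxW
    have h0 := hP (Nat.find hex) (Nat.find_spec hex)
    refine ⟨hex, h0.1, h0.2.2, ?_⟩
    refine exists_int_smul_of_tendsto (norm_frameVector_eq_one h0.1) (fun i => ?_) hlim
    by_cases hxi : x ∈ W i
    · have hi := hP i hxi
      have hspan : Submodule.span ℝ (range (ξ i x)) = Submodule.span ℝ (range (ξ (Nat.find hex) x)) := by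
        rw [← SetLike.coe_set_eq, hi.2.2, h0.2.2]
      obtain ⟨n, hn⟩ := exists_int_smul_frameVector_of_span_eq h0.1 hi.1 hspan (θ i x)
      exact ⟨n, by rw [hG]; simp only [indicator_of_mem hxi, hF]; exact hn⟩
    · exact ⟨0, by rw [hG]; simp only [indicator_of_notMem hxi, Int.cast_zero, zero_smul]⟩
  -- Step 8: the limit data
  let ξlim : V → Fin m → V := fun x => if hx : ∃ i, x ∈ W i then ξ (Nat.find hx) x else fun _ => 0
  let θlim : V → ℤ := fun x =>
    if h : ∃ n : ℤ, Glim x = (n : ℝ) • frameVector (ξlim x) then h.choose else 0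
  have hFlim : (fun x => (θlim x : ℝ) • frameVector (ξlim x)) =ᵐ[μ] Glim := by
    filter_upwards [hstruct] with x ⟨hex, hon, hsp, n, hn⟩
    have hξ : ξlim x = ξ (Nat.find hex) x := dif_pos hex
    have h : ∃ n : ℤ, Glim x = (n : ℝ) • frameVector (ξlim x) := ⟨n, by rw [hξ]; exact hn⟩
    have hθ : θlim x = h.choose := dif_pos h
    rw [hθ]
    exact h.choose_spec.symm
  have hGlim_int : Integrable Glim μ := by
    refine ⟨hGlim_m, ?_⟩
    have h1 : ∫⁻ x, ‖Glim x‖ₑ ∂μ ≤ ∫⁻ x, ‖G 0 x‖ₑ ∂μ + ∫⁻ x, ‖G 0 x - Glim x‖ₑ ∂μ := by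
      rw [← lintegral_add_left' (hGint 0).1.enorm]
      refine lintegral_mono fun x => ?_
      calc ‖Glim x‖ₑ = ‖G 0 x - (G 0 x - Glim x)‖ₑ := by rw [sub_sub_cancel]
        _ ≤ ‖G 0 x‖ₑ + ‖G 0 x - Glim x‖ₑ := enorm_sub_le
    refine h1.trans_lt (ENNReal.add_lt_top.2 ⟨(hGint 0).2, ?_⟩)
    refine (hGlim_bd 0).trans_lt (lt_top_iff_ne_top.2 ?_)
    simpa using hsum'
  have hFlim_int : Integrable (fun x => (θlim x : ℝ) • frameVector (ξlim x)) μ :=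
    hGlim_int.congr hFlim.symm
  have hGlim_li : LocallyIntegrableOn Glim ((⊤ : Opens V) : Set V) μ :=
    hGlim_int.locallyIntegrable.locallyIntegrableOn _
  -- Step 9: admissible limit data
  have hdata : IsRectifiableData (⊤ : Opens V) m Wu θlim ξlim := by
    refine ⟨hWum, by simp, hWur, ?_, ?_⟩
    · rw [← hμ]
      exact hFlim_int.locallyIntegrable.locallyIntegrableOn _
    · rw [← hμ]
      filter_upwards [hstruct] with x ⟨hex, hon, hsp, _⟩
      have hξ : ξlim x = ξ (Nat.find hex) x := dif_pos hex
      rw [hξ]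
      exact ⟨hon, hsp⟩
  -- Step 10: the limit current and mass convergence
  have hT'G : (currentOfIntegration Wu θlim ξlim : Current (⊤ : Opens V) m) =
      vectorCurrent μ Glim := by
    rw [currentOfIntegration, ← hμ]
    exact vectorCurrent_congr_ae hFlim
  have hsptK : (currentOfIntegration Wu θlim ξlim : Current (⊤ : Opens V) m).support ⊆ K :=
    (support_currentOfIntegration_subset_closure _ _ _).trans
      (hK.isClosed.closure_subset_iff.2 hWuK)
  refine ⟨currentOfIntegration Wu θlim ξlim, ⟨⟨Wu, θlim, ξlim, hdata, rfl⟩, ?_⟩, hsptK, ?_⟩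
  · exact Current.isCompact_support_of_subset _ hK (by simp) hsptK
  · have hmi : ∀ i, (T i - currentOfIntegration Wu θlim ξlim).mass = ∫⁻ x, ‖G i x - Glim x‖ₑ ∂μ := by
      intro i
      rw [hTG, hT'G, ← vectorCurrent_sub (hGli i) hGlim_li,
        mass_vectorCurrent_eq_lintegral ((hGli i).sub hGlim_li)]
      rfl
    simp_rw [hmi]
    exact hGlim_L1

end MassComplete

section MassCompleteCauchy

variable {V : Type*} [NormedAddCommGroup V] [InnerProductSpace ℝ V] [FiniteDimensional ℝ V]
  [MeasurableSpace V] [BorelSpace V] {m : ℕ}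

/-- `𝐌(T₁ - T₃) ≤ 𝐌(T₁ - T₂) + 𝐌(T₂ - T₃)`. [cite: Federer1969, 4.1.7] -/
theorem Current.mass_sub_le {E : Type*} [NormedAddCommGroup E] [NormedSpace ℝ E] {Ω : Opens E}
    (T₁ T₂ T₃ : Current Ω m) : (T₁ - T₃).mass ≤ (T₁ - T₂).mass + (T₂ - T₃).mass := by
  have : T₁ - T₃ = (T₁ - T₂) + (T₂ - T₃) := by abel
  rw [this]
  exact Current.mass_add_le _ _

/-- `𝐌(T₁ - T₂) = 𝐌(T₂ - T₁)`. [cite: Federer1969, 4.1.7] -/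
theorem Current.mass_sub_comm {E : Type*} [NormedAddCommGroup E] [NormedSpace ℝ E] {Ω : Opens E}
    (T₁ T₂ : Current Ω m) : (T₁ - T₂).mass = (T₂ - T₁).mass := by
  rw [← neg_sub, Current.mass_neg]

/-- **`𝐌`-completeness of `𝓡_{m,K}(V)`** ("𝓡_{m,K}(U) and 𝓡_{m+1,K}(U) are 𝐌 complete"): an
`𝐌`-Cauchy sequence of rectifiable currents on `V` with supports in a fixed compact `K` converges
in mass to a rectifiable current supported in `K` (pass to a subsequence with
`𝐌(T_{ι(k+1)} − T_{ι k}) < 2^{-k}` and apply the summable form). [cite: Federer1969, 4.1.24] -/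
theorem Current.IsRectifiable.complete_mass {K : Set V} (hK : IsCompact K)
    (T : ℕ → Current (⊤ : Opens V) m) (hT : ∀ i, (T i).IsRectifiable)
    (hTK : ∀ i, (T i).support ⊆ K)
    (hC : ∀ ε : ℝ≥0∞, 0 < ε → ∃ N, ∀ i, N ≤ i → ∀ j, N ≤ j → (T i - T j).mass < ε) :
    ∃ T' : Current (⊤ : Opens V) m, T'.IsRectifiable ∧ T'.support ⊆ K ∧
      Tendsto (fun i => (T i - T').mass) atTop (𝓝 0) := by
  -- moduli of Cauchy-ness at the scales `2^{-k}`
  have hεk : ∀ k : ℕ, (0 : ℝ≥0∞) < (2⁻¹ : ℝ≥0∞) ^ k := fun k =>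
    ENNReal.pow_pos (ENNReal.inv_pos.2 ENNReal.ofNat_ne_top) k
  choose N hN using fun k => hC _ (hεk k)
  -- a strictly increasing subsequence with `ι k ≥ N k`
  let ι : ℕ → ℕ := fun k => (∑ j ∈ Finset.range (k + 1), N j) + k
  have hιN : ∀ k l, k ≤ l → N k ≤ ι l := fun k l hkl =>
    le_add_right (Finset.single_le_sum (fun j _ => Nat.zero_le (N j))
      (Finset.mem_range.2 (Nat.lt_succ_of_le hkl)))
  have hι : StrictMono ι := by
    refine strictMono_nat_of_lt_succ fun k => ?_
    simp only [ι, Finset.sum_range_succ _ (k + 1)]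
    omega
  -- the subsequence has summable mass increments
  have hsum : ∑' k, (T (ι (k + 1)) - T (ι k)).mass ≠ ⊤ := by
    have h1 : ∀ k, (T (ι (k + 1)) - T (ι k)).mass ≤ (2⁻¹ : ℝ≥0∞) ^ k := fun k =>
      (hN k _ (hιN k (k + 1) (Nat.le_succ k)) _ (hιN k k le_rfl)).le
    refine ne_top_of_le_ne_top ?_ (ENNReal.tsum_le_tsum h1)
    rw [ENNReal.tsum_geometric, ENNReal.one_sub_inv_two, inv_inv]
    exact ENNReal.ofNat_ne_top
  obtain ⟨T', hT', hT'K, hlim⟩ := Current.IsRectifiable.exists_limit_of_tsum_mass_ne_top hK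
    (fun k => T (ι k)) (fun k => hT _) (fun k => hTK _) hsum
  refine ⟨T', hT', hT'K, ?_⟩
  -- back to the full sequence
  rw [ENNReal.tendsto_atTop_zero]
  intro ε hε
  have hε2 : 0 < ε / 2 := ENNReal.half_pos hε.ne'
  obtain ⟨k₁, hk₁⟩ := (ENNReal.tendsto_atTop_zero.1 hlim) (ε / 2) hε2
  obtain ⟨N₀, hN₀⟩ := hC (ε / 2) hε2
  refine ⟨N₀, fun i hi => ?_⟩
  -- compare through `T (ι k)` with `k = max k₁ N₀` (so `ι k ≥ N₀`)
  set k := max k₁ N₀ with hk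
  have hιk : N₀ ≤ ι k := le_trans (le_max_right _ _) (le_trans (Nat.le_add_left k _) le_rfl)
  calc (T i - T').mass ≤ (T i - T (ι k)).mass + (T (ι k) - T').mass := Current.mass_sub_le _ _ _
    _ ≤ ε / 2 + ε / 2 := add_le_add (hN₀ i hi _ hιk).le (hk₁ k (le_max_left _ _))
    _ = ε := ENNReal.add_halves ε

end MassCompleteCauchy

end Literature.Geometry.GeometricMeasureTheory
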